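import Mathlib
import Summits.NavierStokesRegularity.NavierStokesRegularity.Theorems.EulerZoomLiouvillePowerGaugeEulerLiouvilleFrozenVorticityMember
import HarnessLib

/-!
# Crux `EulerZoomLiouville.PowerGaugeEulerLiouville` (stmt-NavierStokesRegularity-19832), stub `stub_nonSelfSimilarRest`:
# WEAK KILLING FIELDS ARE WEAKLY HARMONIC — tools for the frozen-strain stratum (`…FrozenStrainMember`)

Helper file (theorems only; `--supports stmt-NavierStokesRegularity-19832`; def-free).  Hand leafhand-ns-eulerzoomliouville-10 g3; the «dual» of
`…FrozenVorticityMember` (frozen antisymmetric part of `∇u`): here the SYMMETRIC part — the rate-of-strain tensor — is frozen.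

PRINCIPLE.  If `∂ₜ sym ∇u = 0` in `𝒟'((−∞,T₁) × ℝ³)`, the time-tested field `w_θ = ∫θ'(t)u(t,·)dt` is a weak KILLING field: it annihilates the
symmetric pairs `(∂ₐg)c + (∂_c g)a`.  A weak Killing field is weakly divergence-free (`a = c`) and weakly HARMONIC
(`FrozenStrain.integral_laplacian_mul_inner_eq_zero_of_symPair`, from the pointwise identity
`(Δθ)a = Σᵢ[(∂ᵢ∂ᵢθ)a + (∂ₐ∂ᵢθ)eᵢ] − ∇(∂ₐθ)`), so the `A`-gauge growth kills it (`ae_eq_zero_of_weaklyHarmonic_of_growth`): `∂ₜu = 0` in `𝒟'`, and the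
member is trivial (`DistSteady.exists_ae_eq_slice`, `AePastSteady.ae_eq_zero_of_gauge_of_aePastSteady`).  In Seregin's class NEITHER THE VORTICITY NOR
THE STRAIN can be time-independent in the far past unless the flow is trivial.

* `FrozenStrain.integral_laplacian_mul_inner_eq_zero_of_symPair`, `FrozenStrain.timeTested_ae_eq_zero_of_symPair` — pure analysis;
* `FrozenStrain.integral_deriv_mul_inner_eq_zero` — `A`-gauge + frozen weak strain ⇒ distributionally steady;
* `Loc.ae_eq_zero_of_frozenStrain`, `Loc.ae_eq_zero_of_aeFrozenWeakStrain` — member level (distributional / a.e. form on `H`);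
* `Birth.nonSelfSimilar_of_aeFrozenWeakStrain` — binder language: `sym H(t,x) = sym W(x)` a.e. on the past slab, `W` time-independent ⇒ trivial.

WHAT THIS IS NOT: not a proof of the stub or of the crux; nothing about Navier–Stokes. [folklore; LemarieRieusset2016 Thm 4.4]
-/

noncomputable section

-- flat `Theorems/<Route><Decl>…` files of one crux share the namespace of the crux (tree convention)
set_option linter.dupNamespace false

open MeasureTheory Set Filter Topology Metric Function TopologicalSpace
open scoped RealInnerProductSpace NNReal ENNReal ContDiff Laplacian

namespace Summit.NavierStokesRegularity.NavierStokesRegularity.Theorems.PowerGaugeEulerLiouville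

open Literature.Analysis Literature.Analysis.FunctionSpaces Literature.Analysis.FluidPDE

namespace FrozenStrain

/-! ## 1. Weak Killing fields are weakly harmonic -/

/-- **`(Δθ) a = Σᵢ [(∂ᵢ∂ᵢθ) a + (∂ₐ∂ᵢθ) eᵢ] − ∇(∂ₐθ)`** pointwise, for `θ ∈ C²` and an orthonormal frame (Schwarz); the summands are the
symmetric pairs of the partial derivatives `∂ᵢθ`. [folklore] -/
theorem laplacian_smul_eq_sum_symPair_sub_gradient {ι : Type*} [Fintype ι] (b : OrthonormalBasis ι ℝ (EuclideanSpace ℝ (Fin 3)))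
    {θ : EuclideanSpace ℝ (Fin 3) → ℝ} (hθ : ContDiff ℝ 2 θ) (a x : EuclideanSpace ℝ (Fin 3)) :
    (Δ θ) x • a = (∑ i, (fderiv ℝ (fun y => fderiv ℝ θ y (b i)) x (b i) • a +
        fderiv ℝ (fun y => fderiv ℝ θ y (b i)) x a • b i)) - gradient (fun y => fderiv ℝ θ y a) x := by
  -- adapted from Literature/Analysis/FluidPDE/DivCurlAnnihilator.lean (`laplacian_smul_eq_gradient_add_sum_curlPair`)
  rw [Finset.sum_add_distrib, ← Finset.sum_smul, ← laplacian_eq_sum_fderiv_fderiv b hθ x, gradient_eq_sum_fderiv_smul b]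
  have hsw : ∑ i, fderiv ℝ (fun y => fderiv ℝ θ y (b i)) x a • b i =
      ∑ i, fderiv ℝ (fun y => fderiv ℝ θ y a) x (b i) • b i :=
    Finset.sum_congr rfl fun i _ => by rw [fderiv_fderiv_apply_comm hθ x a (b i)]
  rw [hsw]
  abel

/-- A symmetric pair `(∂ₐg) c + (∂_c g) a` of a scalar test function is a (vector) test function. [folklore] -/
theorem isTestFunctionOn_symPair {g : EuclideanSpace ℝ (Fin 3) → ℝ} (hg : IsTestFunctionOn (⊤ : Opens (EuclideanSpace ℝ (Fin 3))) g)
    (a c : EuclideanSpace ℝ (Fin 3)) :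
    IsTestFunctionOn (⊤ : Opens (EuclideanSpace ℝ (Fin 3))) fun x => fderiv ℝ g x a • c + fderiv ℝ g x c • a where
  contDiff := ((hg.fderiv_apply_const a).contDiff.smul contDiff_const).add ((hg.fderiv_apply_const c).contDiff.smul contDiff_const)
  hasCompactSupport := ((hg.fderiv_apply_const a).hasCompactSupport.smul_right (f' := fun _ => c)).add
    ((hg.fderiv_apply_const c).hasCompactSupport.smul_right (f' := fun _ => a))
  tsupport_subset := by simp

/-- **A weak Killing field is weakly divergence free**: if `w` annihilates all symmetric pairs, then `∫⟪w, ∇g⟫ = 0` (`∇g = Σᵢ (∂ᵢg) eᵢ`, and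
`2(∂ᵢg)eᵢ` is the symmetric pair with `a = c = eᵢ`). [folklore] -/
theorem isWeaklyDivFree_of_symPair {w : EuclideanSpace ℝ (Fin 3) → EuclideanSpace ℝ (Fin 3)} (hwl : LocallyIntegrable w volume)
    (hsym : ∀ g : EuclideanSpace ℝ (Fin 3) → ℝ, IsTestFunctionOn (⊤ : Opens (EuclideanSpace ℝ (Fin 3))) g →
      ∀ a c : EuclideanSpace ℝ (Fin 3), ∫ x, ⟪w x, fderiv ℝ g x a • c + fderiv ℝ g x c • a⟫ = 0) :
    IsWeaklyDivFree w := by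
  intro g hg
  set b := stdOrthonormalBasis ℝ (EuclideanSpace ℝ (Fin 3)) with hb
  have hterm : ∀ i, Integrable (fun x => ⟪w x, fderiv ℝ g x (b i) • b i⟫) volume := fun i =>
    integrable_inner_of_locallyIntegrable_of_hasCompactSupport hwl
      ((hg.fderiv_apply_const (b i)).contDiff.smul contDiff_const).continuous
      ((hg.fderiv_apply_const (b i)).hasCompactSupport.smul_right (f' := fun _ => b i))
  have hzero : ∀ i, ∫ x, ⟪w x, fderiv ℝ g x (b i) • b i⟫ = 0 := by
    intro i
    have h2 := hsym g hg (b i) (b i)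
    have e : (fun x => ⟪w x, fderiv ℝ g x (b i) • b i + fderiv ℝ g x (b i) • b i⟫) =
        fun x => (2 : ℝ) * ⟪w x, fderiv ℝ g x (b i) • b i⟫ := by
      funext x
      rw [inner_add_right]
      ring
    rw [e, integral_const_mul] at h2
    linarith
  have hpt : ∀ x, ⟪w x, gradient g x⟫ = ∑ i, ⟪w x, fderiv ℝ g x (b i) • b i⟫ := fun x => by
    rw [gradient_eq_sum_fderiv_smul b g x, inner_sum]
  simp_rw [hpt]
  rw [integral_finsetSum _ fun i _ => hterm i]
  exact Finset.sum_eq_zero fun i _ => hzero i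

/-- **Weak Killing fields are weakly harmonic.**  If `w ∈ L¹_loc(ℝ³; ℝ³)` annihilates every symmetric pair `(∂ₐg) c + (∂_c g) a` of a scalar test
function `g`, then every component of `w` is weakly harmonic: `∫ Δθ ⟪w, a⟫ = 0` (pair `w` with `laplacian_smul_eq_sum_symPair_sub_gradient`; the
gradient term vanishes by `isWeaklyDivFree_of_symPair`). [folklore] -/
theorem integral_laplacian_mul_inner_eq_zero_of_symPair {w : EuclideanSpace ℝ (Fin 3) → EuclideanSpace ℝ (Fin 3)}
    (hwl : LocallyIntegrable w volume)
    (hsym : ∀ g : EuclideanSpace ℝ (Fin 3) → ℝ, IsTestFunctionOn (⊤ : Opens (EuclideanSpace ℝ (Fin 3))) g →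
      ∀ a c : EuclideanSpace ℝ (Fin 3), ∫ x, ⟪w x, fderiv ℝ g x a • c + fderiv ℝ g x c • a⟫ = 0)
    {θ : EuclideanSpace ℝ (Fin 3) → ℝ} (hθ : IsTestFunctionOn (⊤ : Opens (EuclideanSpace ℝ (Fin 3))) θ) (a : EuclideanSpace ℝ (Fin 3)) :
    ∫ x, (Δ θ) x * ⟪w x, a⟫ = 0 := by
  -- adapted from Literature/Analysis/FluidPDE/DivCurlAnnihilator.lean (`integral_laplacian_mul_inner_eq_zero_of_curlPair`)
  have hdiv := isWeaklyDivFree_of_symPair hwl hsym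
  set b := stdOrthonormalBasis ℝ (EuclideanSpace ℝ (Fin 3)) with hb
  have hθ2 : ContDiff ℝ 2 θ := contDiff_infty.1 hθ.contDiff 2
  have hga : IsTestFunctionOn (⊤ : Opens (EuclideanSpace ℝ (Fin 3))) (fun y => fderiv ℝ θ y a) := hθ.fderiv_apply_const a
  have hgi : ∀ i, IsTestFunctionOn (⊤ : Opens (EuclideanSpace ℝ (Fin 3))) (fun y => fderiv ℝ θ y (b i)) :=
    fun i => hθ.fderiv_apply_const (b i)
  -- the gradient term
  have hG_smooth : ContDiff ℝ (⊤ : ℕ∞) (gradient fun y => fderiv ℝ θ y a) := by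
    refine contDiff_infty.2 fun n => ?_
    exact (InnerProductSpace.toDual ℝ (EuclideanSpace ℝ (Fin 3))).symm.contDiff.comp
      (hga.contDiff.fderiv_right (m := n) (by exact_mod_cast le_top))
  have hG_supp : HasCompactSupport (gradient fun y => fderiv ℝ θ y a) :=
    (hga.hasCompactSupport.fderiv (𝕜 := ℝ)).comp_left
      (g := (InnerProductSpace.toDual ℝ (EuclideanSpace ℝ (Fin 3))).symm) (map_zero _)
  have iG : Integrable (fun x => ⟪w x, gradient (fun y => fderiv ℝ θ y a) x⟫) volume :=
    integrable_inner_of_locallyIntegrable_of_hasCompactSupport hwl hG_smooth.continuous hG_supp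
  have eG : ∫ x, ⟪w x, gradient (fun y => fderiv ℝ θ y a) x⟫ = 0 := hdiv _ hga
  -- the symmetric-pair terms
  set K : Fin (Module.finrank ℝ (EuclideanSpace ℝ (Fin 3))) → EuclideanSpace ℝ (Fin 3) → EuclideanSpace ℝ (Fin 3) := fun i x =>
    fderiv ℝ (fun y => fderiv ℝ θ y (b i)) x (b i) • a +
      fderiv ℝ (fun y => fderiv ℝ θ y (b i)) x a • b i with hK_def
  have hKt : ∀ i, IsTestFunctionOn (⊤ : Opens (EuclideanSpace ℝ (Fin 3))) (K i) := fun i =>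
    isTestFunctionOn_symPair (hgi i) (b i) a
  have iK : ∀ i, Integrable (fun x => ⟪w x, K i x⟫) volume := fun i =>
    integrable_inner_of_locallyIntegrable_of_hasCompactSupport hwl (hKt i).contDiff.continuous (hKt i).hasCompactSupport
  have eK : ∀ i, ∫ x, ⟪w x, K i x⟫ = 0 := fun i => hsym _ (hgi i) (b i) a
  have hpt : ∀ x, (Δ θ) x * ⟪w x, a⟫ = (∑ i, ⟪w x, K i x⟫) - ⟪w x, gradient (fun y => fderiv ℝ θ y a) x⟫ := fun x => by
    rw [← real_inner_smul_right, laplacian_smul_eq_sum_symPair_sub_gradient b hθ2 a x, inner_sub_right, inner_sum]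
  simp_rw [hpt]
  rw [integral_sub (integrable_finsetSum _ fun i _ => iK i) iG, integral_finsetSum _ fun i _ => iK i, eG, sub_zero]
  exact Finset.sum_eq_zero fun i _ => eK i

/-! ## 2. The time-tested field of a frozen-strain flow vanishes -/

/-- **A TIME-TESTED FIELD ANNIHILATING THE SYMMETRIC PAIRS, OF SUB-VOLUME GROWTH, VANISHES** (weak Killing + growth ⇒ weakly harmonic of sub-volume
growth ⇒ zero). [folklore] -/
theorem timeTested_ae_eq_zero_of_symPair {u : ℝ → EuclideanSpace ℝ (Fin 3) → EuclideanSpace ℝ (Fin 3)} {T : ℝ}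
    (hu : LocallyIntegrableOn (uncurry u) (Iio T ×ˢ (univ : Set (EuclideanSpace ℝ (Fin 3)))) volume)
    {κ : ℝ → ℝ} (hκ : Continuous κ) (hκc : HasCompactSupport κ) (hκT : tsupport κ ⊆ Iio T)
    (hsym : ∀ g : EuclideanSpace ℝ (Fin 3) → ℝ, IsTestFunctionOn (⊤ : Opens (EuclideanSpace ℝ (Fin 3))) g →
      ∀ a c : EuclideanSpace ℝ (Fin 3),
        ∫ z : ℝ × EuclideanSpace ℝ (Fin 3), κ z.1 * ⟪u z.1 z.2, fderiv ℝ g z.2 a • c + fderiv ℝ g z.2 c • a⟫ = 0)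
    {K m r₀ : ℝ} (hm : m < 3)
    (hgrowth : ∀ r : ℝ, r₀ < r → 0 < r →
      ∫⁻ x in ball (0 : EuclideanSpace ℝ (Fin 3)) r, ‖∫ t, κ t • u t x‖ₑ ^ 2 ≤ ENNReal.ofReal (K * r ^ m)) :
    (fun x => ∫ t, κ t • u t x) =ᵐ[volume] (0 : EuclideanSpace ℝ (Fin 3) → EuclideanSpace ℝ (Fin 3)) := by
  -- adapted from `AntiMember.timeTested_ae_eq_zero` (…WeakTimeTestedField)
  set w : EuclideanSpace ℝ (Fin 3) → EuclideanSpace ℝ (Fin 3) := fun x => ∫ t, κ t • u t x with hw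
  have hwl : LocallyIntegrable w volume := AntiMember.locallyIntegrable_timeTested hu hκ hκc hκT
  have hwsym : ∀ g : EuclideanSpace ℝ (Fin 3) → ℝ, IsTestFunctionOn (⊤ : Opens (EuclideanSpace ℝ (Fin 3))) g →
      ∀ a c : EuclideanSpace ℝ (Fin 3), ∫ x, ⟪w x, fderiv ℝ g x a • c + fderiv ℝ g x c • a⟫ = 0 := by
    intro g hg a c
    have hT := isTestFunctionOn_symPair hg a c
    show ∫ x, ⟪(∫ t, κ t • u t x), fderiv ℝ g x a • c + fderiv ℝ g x c • a⟫ = 0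
    rw [AntiMember.integral_inner_timeTested hu hκ hκc hκT hT.contDiff.continuous hT.hasCompactSupport]
    exact hsym g hg a c
  have hcoord : ∀ i : Fin 3, (fun x => ⟪w x, EuclideanSpace.single i (1 : ℝ)⟫) =ᵐ[volume] 0 := by
    intro i
    set a : (EuclideanSpace ℝ (Fin 3)) := EuclideanSpace.single i (1 : ℝ) with ha
    have ha1 : ‖a‖ = 1 := by
      rw [ha, PiLp.norm_single, norm_one]
    refine ae_eq_zero_of_weaklyHarmonic_of_growth (K := K) (m := m) (r₀ := r₀) ?_ ?_ hm ?_
    · have e1 : (fun x => ⟪w x, a⟫) = fun x => (innerSL ℝ a) (w x) := by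
        funext x; simp only [innerSL_apply_apply, real_inner_comm]
      rw [e1, ← locallyIntegrableOn_univ]
      exact (innerSL ℝ a).locallyIntegrableOn_comp (locallyIntegrableOn_univ.2 hwl)
    · intro φ hφ hφc
      have hθ : IsTestFunctionOn (⊤ : Opens (EuclideanSpace ℝ (Fin 3))) φ := ⟨hφ, hφc, by simp⟩
      have := integral_laplacian_mul_inner_eq_zero_of_symPair hwl hwsym hθ a
      rw [← this]
      exact integral_congr_ae (Eventually.of_forall fun x => by simp only [mul_comm])
    · intro r hr hr0
      refine le_trans (lintegral_mono fun x => ?_) (hgrowth r hr hr0)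
      gcongr
      rw [← ofReal_norm, ← ofReal_norm]
      exact ENNReal.ofReal_le_ofReal ((norm_inner_le_norm _ _).trans (by rw [ha1, mul_one]))
  have hall := ae_all_iff.2 hcoord
  filter_upwards [hall] with x hx
  ext i
  have h1 := hx i
  simp only [Pi.zero_apply] at h1
  rw [EuclideanSpace.inner_single_right] at h1
  simpa using h1

end FrozenStrain

end Summit.NavierStokesRegularity.NavierStokesRegularity.Theorems.PowerGaugeEulerLiouville

end
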